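import Summits.BirchSwinnertonDyer.Rank1Residual.Supersingular.X6RankOneAnticyclotomicLinks
import HarnessLib

/-!
# Class X6 (good supersingular, semistable), analytic rank `1`, `p ≥ 5`: `BSD(E,p)` from the two
# anticyclotomic links AS TYPED ON THE CONSTRUCTED `X_ac` + Sprung 2024 Cor. 1.3 (ii); the census row
# C3 ∩ {supersingular}; NON-VACUITY of the binders (cell `b2b-bsdres`, literature typer seat `lit-cw`
# = Castella–Wan / Wan-line papers, gen 6; companion of `Supersingular/X6RankOneAnticyclotomicLinks.lean`)

HONEST FRAMING (cell `b2b-bsdres`, run/shared/lean/b2b/bsd-rank1-residual/, verbatim in every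
file): the goal of the cell is to DELETE the COMBINATION-SHAPED residual classes of the
Birch–Swinnerton-Dyer formula for ALL analytic-rank `≤ 1` elliptic curves over `ℚ` — "full BSD
formula for every rank `≤ 1` curve in class `C`" assembled STRICTLY from published theorems — so
that the rank-`≤ 1` remainder becomes exactly the CONSTRUCTION-SHAPED classes, which are TYPED
(missing-input `Prop`s), NOT attempted. This is not "finishing BSD". Research routes; no claim
beyond stated classes. THEOREMS ONLY (no definition, no named fact, no `sorry`); nothing about any
curve is asserted; nothing is booked; no label is moved by this file (the referee rules); X6 ∩
{`r_an = 1`} stays CONSTRUCTION-SHAPED. NEW WORK of the cell, hence under `Summits/`.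

## What this file records

The companion derives the LOWER half `Typed.MissingLowerBoundAt W p` on `ClassX6 W p ∧ r_an = 1 ∧
p ≥ 5` from the two links on the tree's constructed `X_ac` — (CTL) `X11b.ControlOnTreeGoodAt`
(Jetchev–Skinner–Wan 2017 Thm. 3.3.1: PUBLISHED at a supersingular `p`, no ordinarity hypothesis in
§3.1) and (IMC≥∘BDP) `X11b.IMCLowerWaldspurgerOnTreeGoodAt` (one divisibility of Castella–Wan 2024
Conj. 5.2 at `𝟙` ∘ Brooks' formula; in refereed print = Castella–Wan 2024 Thm. 5.3 ([CLW22]) ONLY for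
`K` with (ii) "some prime `ℓ ∣ N` is non-split in `K`" — NOT at the all-split classical Heegner data
quantified here, so a TYPED input; CCSS arXiv:1804.10993 / BSTW arXiv:2409.01350 PRE) — demanded at
every Manin-unit classical Heegner datum of the pair (`d_K < −4`, every `ℓ ∣ N` split, `p` split,
`L(E^{d_K},1) ≠ 0`, non-torsion Heegner point, every anticyclotomic `κ`, generator `γ`, degree-one
`𝔭 ∋ p`, THE embedding `X11b.embAt`). Here:

1. `X6.bsdp_of_onTreeGoodLinks_of_sprung` — with Sprung 2024 Cor. 1.3 (ii) (`hS`) for the upper half,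
   `BSD(E,p)` on X6 ∧ {r_an = 1} ∧ {p ≥ 5} from (`hLC`, `hLA`) and published named facts; the
   supersingular twin of the GLUE seat's `RowC3.bsdp_of_onTreeGoodLinks_of_bcsThm112b` (there the
   upper half is the column's cyclotomic main conjecture, here Sprung's signed one-sided bound).
2. `RowC3.bsdp_of_goodSS_of_onTreeGoodLinks_of_sprung` — the same on the census row C3 ∩
   {supersingular, `p ≥ 5`} (`Partition/Rows.lean`, the sub-row flagged `JSW-ss`).
3. `X6.exists_onTreeLinkData` — NON-VACUITY: at every X6 pair with `r_an = 1`, `p ≥ 5` the data at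
   which (`hLC`, `hLA`) are demanded EXIST (field: Friedberg–Hoffstein + modularity for the sign;
   datum: Mazur 1978 Cor. 4.1 + the Néron-scaling THEOREM; non-torsion: Gross–Zagier; `κ, γ, 𝔭`:
   global reciprocity and `p` split) — so the typed input is demanded at existing data, not vacuously.

TIER (reading for the referee; nothing moved): every theorem is CONDITIONAL on `hLA`; X6 ∩ {r_an = 1}
stays CONSTRUCTION-SHAPED with typed residue = one inequality of Castella–Wan Conj. 5.2 at `𝟙` ∘
Brooks on the constructed `X_ac`, given the published (CTL) (companion §3).

References: [CastellaWan2023] Conj. 5.2, Thm. 5.3 (authors' MS p. 23); [JetchevSkinnerWan2017] Thm.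
3.3.1, §3.5, Prop. 5.1.x (Brooks), §7.4.1 (arXiv:1512.06894 pp. 11, 16, 22, 29–31); [Sprung2024] Cor.
1.3 (ii); [Wuthrich2014] Prop. 21; [Mazur1978] Cor. 4.1; [GreenbergLNM1716] §1; [Miller2011LMS] Def.
1.1; HOME/b2b-bsdres-lit-cw/CASTELLA-WAN.md §10.
-/

set_option autoImplicit false

noncomputable section

open scoped Classical

open WeierstrassCurve NumberField IsDedekindDomain Literature.NumberTheory.EllipticCurves
  Literature.NumberTheory.EllipticCurves.ModularForms
  Literature.NumberTheory.EllipticCurves.Rank1Residual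
  Literature.NumberTheory.EllipticCurves.Rank1Residual.Typed
  Literature.NumberTheory.EllipticCurves.Wuthrich2014
  Summit.BirchSwinnertonDyer.Rank1Residual.X11b.AcSelmer

namespace Summit.BirchSwinnertonDyer.Rank1Residual.Supersingular

/-! ### §1 `BSD(E,p)` on X6 ∧ {r_an = 1} ∧ {p ≥ 5} and on row C3 ∩ {supersingular} -/

/-- **The two links on `X_ac` + Sprung 2024 Cor. 1.3 (ii) ⇒ `BSD(E,p)` on X6 ∧ {r_an = 1} ∧ {p ≥ 5}.**
The lower half from `X6.missingLowerBoundAt_of_onTreeGoodLinks` ((CTL) published, (IMC≥∘BDP) typed,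
everything else published by name), the upper half from Sprung's Cor. 1.3 second sentence (`hS`).
CONDITIONAL on `hLA` (and the named facts); X6's label is the referee's; nothing booked.
[cite: Sprung2024, Cor. 1.3 (p. 5), second sentence] [cite: CastellaWan2023, Conj. 5.2, Thm. 5.3 (MS p. 23)]
[cite: JetchevSkinnerWan2017, Thm. 3.3.1, §7.4.1 (pp. 11, 29–31)] [cite: Miller2011LMS, §1 and Def. 1.1] -/
theorem X6.bsdp_of_onTreeGoodLinks_of_sprung
    (hGZ : ∀ (N : ℕ) [NeZero N] (W : WeierstrassCurve ℚ) (K : Type) [Field K] [NumberField K],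
      gross_zagier N W K)
    (hKo : ∀ (N : ℕ) [NeZero N] (W : WeierstrassCurve ℚ) (K : Type) [Field K] [NumberField K],
      kolyvagin N W K)
    (hWu : sha_dvd_analyticSha) (hS : Sprung2024.cor13_padicValRat_bsd_rank_one_le)
    (hGZK : rank_eq_analyticRank_of_analyticRank_le_one) (hmod : hasEntireLFunction_rat)
    (hnf : exists_isNewformOf)
    (hFH : friedbergHoffstein_exists_heegnerField_split_twist_ne_zero)
    (hMaz : mazur_not_dvd_maninConstant_of_odd)
    (W : WeierstrassCurve ℚ) [W.IsElliptic] [W.IsGloballyMinimal] (p : ℕ) [Fact p.Prime]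
    (hX : ClassX6 W p) (hp5 : 5 ≤ p) (hr : W.analyticRank = 1)
    (hLC : ∀ (N : ℕ) [NeZero N] (K : Type) [Field K] [NumberField K]
      (Dt : ModularParametrizationData W N) (H : HeegnerDatum N (NumberField.discr K)) (ι : K →+* ℂ)
      (P : (W.baseChange K).toAffine.Point),
      W.conductorNorm ℤ = N → IsImaginaryQuadratic K → NumberField.discr K < -4 →
      SatisfiesHeegnerHypothesis N K → SatisfiesHeegnerHypothesis p K →
      (W.quadraticTwist (NumberField.discr K : ℚ)).entireLFunction 1 ≠ 0 →
      WeierstrassCurve.Affine.Point.map ι.toRatAlgHom P = heegnerPointComplex Dt H →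
      ¬ (p : ℤ) ∣ Dt.c → ¬ IsOfFinAddOrder P →
      ∀ (κ : ZpExtension K p), κ.IsAnticyclotomic →
        ∀ (γ : Field.absoluteGaloisGroup K) [Fact (κ.IsTopGenerator γ)]
          (𝔭 : HeightOneSpectrum (𝓞 K)) (h𝔭 : ((p : ℕ) : 𝓞 K) ∈ 𝔭.asIdeal)
          (he : 𝔭.asIdeal.ramificationIdx (𝓞 ℚ) = 1) (hf : 𝔭.asIdeal.inertiaDeg (𝓞 ℚ) = 1),
          X11b.ControlOnTreeGoodAt p κ 𝔭 γ (X11b.embAt K p 𝔭 h𝔭 he hf) P)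
    (hLA : ∀ (N : ℕ) [NeZero N] (K : Type) [Field K] [NumberField K]
      (Dt : ModularParametrizationData W N) (H : HeegnerDatum N (NumberField.discr K)) (ι : K →+* ℂ)
      (P : (W.baseChange K).toAffine.Point),
      W.conductorNorm ℤ = N → IsImaginaryQuadratic K → NumberField.discr K < -4 →
      SatisfiesHeegnerHypothesis N K → SatisfiesHeegnerHypothesis p K →
      (W.quadraticTwist (NumberField.discr K : ℚ)).entireLFunction 1 ≠ 0 →
      WeierstrassCurve.Affine.Point.map ι.toRatAlgHom P = heegnerPointComplex Dt H →
      ¬ (p : ℤ) ∣ Dt.c → ¬ IsOfFinAddOrder P →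
      ∀ (κ : ZpExtension K p), κ.IsAnticyclotomic →
        ∀ (γ : Field.absoluteGaloisGroup K) [Fact (κ.IsTopGenerator γ)]
          (𝔭 : HeightOneSpectrum (𝓞 K)) (h𝔭 : ((p : ℕ) : 𝓞 K) ∈ 𝔭.asIdeal)
          (he : 𝔭.asIdeal.ramificationIdx (𝓞 ℚ) = 1) (hf : 𝔭.asIdeal.inertiaDeg (𝓞 ℚ) = 1),
          X11b.IMCLowerWaldspurgerOnTreeGoodAt p κ 𝔭 γ (X11b.embAt K p 𝔭 h𝔭 he hf) P) :
    BSDp W p :=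
  X6.bsdp_of_missingLowerBoundAt_of_analyticRank_eq_one W p hS hGZK hmod (by omega) hX hr
    (X6.missingLowerBoundAt_of_onTreeGoodLinks hGZ hKo hWu hGZK hmod hnf hFH hMaz W p hX hp5 hr hLC hLA)

/-- **Row C3 ∩ {supersingular, `p ≥ 5`}** (`Partition/Rows.lean`; the census sub-row flagged `JSW-ss`):
such a pair is an X6 pair with `r_an = 1`, so `BSD(E,p)` follows from the two links on `X_ac` and
Sprung as above. CONDITIONAL on `hLA`; nothing booked; no label change.
[cite: JetchevSkinnerWan2017, Thm. 1.2.1 and §7.4.1] [cite: CastellaWan2023, Thm. 5.3 (MS p. 23)]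
[cite: Sprung2024, Cor. 1.3 (p. 5), second sentence] -/
theorem RowC3.bsdp_of_goodSS_of_onTreeGoodLinks_of_sprung
    (hGZ : ∀ (N : ℕ) [NeZero N] (W : WeierstrassCurve ℚ) (K : Type) [Field K] [NumberField K],
      gross_zagier N W K)
    (hKo : ∀ (N : ℕ) [NeZero N] (W : WeierstrassCurve ℚ) (K : Type) [Field K] [NumberField K],
      kolyvagin N W K)
    (hWu : sha_dvd_analyticSha) (hS : Sprung2024.cor13_padicValRat_bsd_rank_one_le)
    (hGZK : rank_eq_analyticRank_of_analyticRank_le_one) (hmod : hasEntireLFunction_rat)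
    (hnf : exists_isNewformOf)
    (hFH : friedbergHoffstein_exists_heegnerField_split_twist_ne_zero)
    (hMaz : mazur_not_dvd_maninConstant_of_odd)
    (W : WeierstrassCurve ℚ) [W.IsElliptic] [W.IsGloballyMinimal] (p : ℕ) [Fact p.Prime]
    (h : RowC3 W p) (hss : GoodSS W p) (hp5 : 5 ≤ p)
    (hLC : ∀ (N : ℕ) [NeZero N] (K : Type) [Field K] [NumberField K]
      (Dt : ModularParametrizationData W N) (H : HeegnerDatum N (NumberField.discr K)) (ι : K →+* ℂ)
      (P : (W.baseChange K).toAffine.Point),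
      W.conductorNorm ℤ = N → IsImaginaryQuadratic K → NumberField.discr K < -4 →
      SatisfiesHeegnerHypothesis N K → SatisfiesHeegnerHypothesis p K →
      (W.quadraticTwist (NumberField.discr K : ℚ)).entireLFunction 1 ≠ 0 →
      WeierstrassCurve.Affine.Point.map ι.toRatAlgHom P = heegnerPointComplex Dt H →
      ¬ (p : ℤ) ∣ Dt.c → ¬ IsOfFinAddOrder P →
      ∀ (κ : ZpExtension K p), κ.IsAnticyclotomic →
        ∀ (γ : Field.absoluteGaloisGroup K) [Fact (κ.IsTopGenerator γ)]
          (𝔭 : HeightOneSpectrum (𝓞 K)) (h𝔭 : ((p : ℕ) : 𝓞 K) ∈ 𝔭.asIdeal)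
          (he : 𝔭.asIdeal.ramificationIdx (𝓞 ℚ) = 1) (hf : 𝔭.asIdeal.inertiaDeg (𝓞 ℚ) = 1),
          X11b.ControlOnTreeGoodAt p κ 𝔭 γ (X11b.embAt K p 𝔭 h𝔭 he hf) P)
    (hLA : ∀ (N : ℕ) [NeZero N] (K : Type) [Field K] [NumberField K]
      (Dt : ModularParametrizationData W N) (H : HeegnerDatum N (NumberField.discr K)) (ι : K →+* ℂ)
      (P : (W.baseChange K).toAffine.Point),
      W.conductorNorm ℤ = N → IsImaginaryQuadratic K → NumberField.discr K < -4 →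
      SatisfiesHeegnerHypothesis N K → SatisfiesHeegnerHypothesis p K →
      (W.quadraticTwist (NumberField.discr K : ℚ)).entireLFunction 1 ≠ 0 →
      WeierstrassCurve.Affine.Point.map ι.toRatAlgHom P = heegnerPointComplex Dt H →
      ¬ (p : ℤ) ∣ Dt.c → ¬ IsOfFinAddOrder P →
      ∀ (κ : ZpExtension K p), κ.IsAnticyclotomic →
        ∀ (γ : Field.absoluteGaloisGroup K) [Fact (κ.IsTopGenerator γ)]
          (𝔭 : HeightOneSpectrum (𝓞 K)) (h𝔭 : ((p : ℕ) : 𝓞 K) ∈ 𝔭.asIdeal)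
          (he : 𝔭.asIdeal.ramificationIdx (𝓞 ℚ) = 1) (hf : 𝔭.asIdeal.inertiaDeg (𝓞 ℚ) = 1),
          X11b.IMCLowerWaldspurgerOnTreeGoodAt p κ 𝔭 γ (X11b.embAt K p 𝔭 h𝔭 he hf) P) :
    BSDp W p := by
  obtain ⟨hr, hsst, -, -, -⟩ := h
  have hX : ClassX6 W p := ⟨hss, hsst, Or.inl hp5⟩
  exact X6.bsdp_of_onTreeGoodLinks_of_sprung hGZ hKo hWu hS hGZK hmod hnf hFH hMaz W p hX hp5 hr hLC hLA

/-! ### §2 Non-vacuity: the data at which the links are demanded exist at every X6 pair -/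

/-- **NON-VACUITY of the binders `hLC` / `hLA`**: at every X6 pair with `r_an = 1` and `p ≥ 5` there
EXIST an imaginary quadratic `K` with `d_K < −4`, every `ℓ ∣ N` split, `p` split and
`L(E^{d_K},1) ≠ 0` (Friedberg–Hoffstein `hFH`, sign `−1` by modularity `hnf`), a Manin-unit
parametrisation datum of level `N` with its Heegner point `P` (`X11b.exists_maninDatum_of_good`:
`hnf`, Mazur 1978 `hMaz`, Néron scaling a tree theorem; `E[p]` irreducible is automatic on X6),
`P` NON-TORSION (Gross–Zagier `hGZ` + `hmod`), and an anticyclotomic `ℤ_p`-extension `κ`, a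
topological generator `γ` and a DEGREE-ONE prime `𝔭 ∋ p` of `𝓞_K`
(`X11b.exists_anticyclotomic_generator_degreeOnePrime`). So the class theorems above demand their
typed input at existing data, not vacuously. [cite: Mazur1978, Cor. 4.1]
[cite: GreenbergLNM1716, §1 (the anticyclotomic ℤ_p-extension)] [cite: GrossZagier1986, Thm. I.(6.3)] -/
theorem X6.exists_onTreeLinkData
    (hGZ : ∀ (N : ℕ) [NeZero N] (W : WeierstrassCurve ℚ) (K : Type) [Field K] [NumberField K],
      gross_zagier N W K)
    (hmod : hasEntireLFunction_rat) (hnf : exists_isNewformOf)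
    (hFH : friedbergHoffstein_exists_heegnerField_split_twist_ne_zero)
    (hMaz : mazur_not_dvd_maninConstant_of_odd)
    (W : WeierstrassCurve ℚ) [W.IsElliptic] [W.IsGloballyMinimal] (p : ℕ) [Fact p.Prime]
    [NeZero (W.conductorNorm ℤ)] (hX : ClassX6 W p) (hp5 : 5 ≤ p) (hr : W.analyticRank = 1) :
    ∃ (K : Type) (_ : Field K) (_ : NumberField K)
      (Dt : ModularParametrizationData W (W.conductorNorm ℤ))
      (H : HeegnerDatum (W.conductorNorm ℤ) (NumberField.discr K)) (ι : K →+* ℂ)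
      (P : (W.baseChange K).toAffine.Point)
      (κ : ZpExtension K p) (γ : Field.absoluteGaloisGroup K) (𝔭 : HeightOneSpectrum (𝓞 K)),
      IsImaginaryQuadratic K ∧ NumberField.discr K < -4 ∧
        SatisfiesHeegnerHypothesis (W.conductorNorm ℤ) K ∧ SatisfiesHeegnerHypothesis p K ∧
        (W.quadraticTwist (NumberField.discr K : ℚ)).entireLFunction 1 ≠ 0 ∧
        WeierstrassCurve.Affine.Point.map ι.toRatAlgHom P = heegnerPointComplex Dt H ∧
        ¬ (p : ℤ) ∣ Dt.c ∧ ¬ IsOfFinAddOrder P ∧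
        κ.IsAnticyclotomic ∧ κ.IsTopGenerator γ ∧ ((p : ℕ) : 𝓞 K) ∈ 𝔭.asIdeal ∧
        𝔭.asIdeal.ramificationIdx (𝓞 ℚ) = 1 ∧ 𝔭.asIdeal.inertiaDeg (𝓞 ℚ) = 1 := by
  have hp : p.Prime := Fact.out
  have hp2 : p ≠ 2 := by omega
  have hgood : W.HasGoodReductionAtPrime p := hX.1.1
  have hirr : Irr W p := ClassX6.irr W p hp2 hX
  have hw : W.rootNumber = -1 := by
    rw [WeierstrassCurve.rootNumber_eq_neg_one_pow_analyticRank_of_exists_isNewformOf hnf W, hr]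
    norm_num
  obtain ⟨K, iF, iNF, hK, hdisc, hHN, hHp, hLt⟩ := hFH W hw p hp 4
  haveI : IsTotallyComplex K := hK.2
  have hneg : NumberField.discr K < 0 := discr_neg_of_finrank_eq_two K hK.1
  have h4 : NumberField.discr K < -4 := by
    have habs : ((NumberField.discr K).natAbs : ℤ) = -NumberField.discr K :=
      Int.ofNat_natAbs_of_nonpos hneg.le
    have : (4 : ℤ) < ((NumberField.discr K).natAbs : ℤ) := by exact_mod_cast hdisc
    omega
  obtain ⟨Dt, H, ι, P, hP, hc⟩ :=
    X11b.exists_maninDatum_of_good hnf hMaz integral_neronScaling_of_isGloballyMinimal_holds W p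
      (W.conductorNorm ℤ) K rfl hp2 hgood hirr hK hHN
  have hPinf : ¬ IsOfFinAddOrder P :=
    X11b.not_isOfFinAddOrder_of_heegner_of_analyticRank_eq_one W (W.conductorNorm ℤ) K Dt H ι P
      (hGZ _ W K) hmod hr hK hHN hLt hP
  obtain ⟨κ, γ, 𝔭, hκ, hγ, h𝔭, he, hf⟩ :=
    X11b.exists_anticyclotomic_generator_degreeOnePrime p K hK hHp
  exact ⟨K, iF, iNF, Dt, H, ι, P, κ, γ, 𝔭, hK, h4, hHN, hHp, hLt, hP, hc, hPinf, hκ, hγ, h𝔭, he, hf⟩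

end Summit.BirchSwinnertonDyer.Rank1Residual.Supersingular

end
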